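import Literature.NumberTheory.EllipticCurves.CuspFormTwistGamma1
import Literature.NumberTheory.EllipticCurves.CuspFormLFunctionEulerProductProofs
import Literature.NumberTheory.EllipticCurves.NewformsLiftProofs
import HarnessLib

/-!
# The `α`-stabilised untwist: from `q`-EXPANSIONS to the FUNCTIONAL IDENTITY `G − α·G(p·) = ∑ᵤ η(u) f(· + u/m)`
# on `ℍ` (route `CyclotomicUntwist`, crux K1 `PSRankOneLowerHalfAtThree`, child C1 `PSUntwistedLFunctionAtThree`)

Cell `pub/bsd-wall` (D-0145 line `route-BirchSwinnertonDyer-CyclotomicUntwist`), width seat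
`bsd-line-cycu-p5` (gen 13). THEOREMS ONLY (no definition, no named fact, no `sorry`); helper
`--supports stmt-BirchSwinnertonDyer-21580`. BSD is not proved by this file and no crux or child of the
route is proved by it; K1/K2 stay OPEN and WHOLE.

WHERE IT SITS. The lattice road to the existence child C1 (stmt-27548) of `bsd-line-cycu-p3` g9 —
`PSF1OfLattice.exists_isPSCyclotomicLFunctionOf_of_lattice` (p644718) fed by
`PSStabilisedTwist.psi_sub_eq_sum_ratPlusSymbol` (p645240) and the `Γ₁` symbol lattice of `bsd-line-cycu-p4`
(p644932) — takes as its one modular HYPOTHESIS the functional identity on `ℍ`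

  (★)  `G(τ) − α·G(pτ) = κ · ∑_{u mod p^c} η(u) f(τ + u/p^c)`   (`G` a weight-`2` cusp form on some `Γ₁(L)`),

the `α`-STABILISED UNTWIST of the newform `f` (`PSStabilisedTwist`, hypothesis `hG`; "this file does not
construct `G`"). The present file CONSTRUCTS `G` from `q`-expansion data and proves (★) for it:

* §1 `apply_sub_mul_apply_mul_eq_of_cuspCoeff` — cusp forms `G`, `H` of any levels (strict period `1`)
  and weights: if `aₙ(G) − α·[p ∣ n]·a_{n/p}(G) = aₙ(H)` for all `n`, then `G(τ) − α·G(pτ) = H(τ)` on `ℍ`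
  (the three `q`-expansions converge, `𝕢(pτ) = 𝕢(τ)^p`, re-index `n ↦ pn`).
* §2 `cuspCoeff_eq_inv_mul_of_packet` — for a newform `f ∈ S_k(Γ₀(N))`, a character `η` mod `m`,
  `p ∣ m`, and ANY newform `g₀ ∈ S_k(Γ₁(N₀))` with the eigenpacket of `f ⊗ η⁻¹` off `p`
  (`a_ℓ(g₀) = η⁻¹(ℓ)a_ℓ(f)` for primes `ℓ ≠ p`, `ε_{g₀}(ℓ) = η⁻¹(ℓ)²` for primes `ℓ ∤ N m`, `ℓ ∣ N₀` for
  primes `ℓ ∣ N m`, `ℓ ≠ p`): `aₙ(g₀) = η⁻¹(n)·aₙ(f)` for all `n` prime to `p` (multiplicativity and the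
  prime-power Hecke recursions on both levels); `cuspCoeff_prime_mul_of_dvd_level` (`U_p`, `p ∣ N₀`).
* §3 `stabilisedUntwist_sub_mul_apply_mul_eq_twistRaw` / `…_eq_sum` / `stabilisedUntwist_hG`: for
  PRIMITIVE `η`, `α := a_p(g₀)`, `G := τ(η)•g₀` (`τ(η)` the Gauss sum):
  `G(τ) − α·G(pτ) = (twistRaw L _ _ f η⁻¹)(τ) = ∑_{u mod m} η(u) f(u/m +ᵥ τ)` on `ℍ` — (★) with `κ = 1`,
  in EXACTLY the shape of the hypothesis `hG` of `PSStabilisedTwist` when `m = p^c`.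
* §4 `exists_stabilisedUntwist_of_residualPacket` — with the tree's newform-of-a-twist
  (`exists_isNewform1_twist`: the packet at every prime `ℓ ∤ N m`), GRANTED the residual packet
  statement «a newform with the packet of `f ⊗ η⁻¹` off `N m` has it also at the primes `ℓ ∣ N m`,
  `ℓ ≠ p`, and `p`, `ℓ` divide its level» (Atkin–Li 1978, Thm. 3.2 / Cor. 3.1 — a HYPOTHESIS here,
  not asserted), such a `g₀` exists. For the route: `p = 3`, `m = 9`, `f = f_W` (`N = 81M`), `g₀` the
  untwist of level `9M`; the root relation `α² − a_w α + 3 = 0` is the remaining print residue.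

References: [cite: Shimura1971, Prop. 3.64] · [cite: DiamondShurman2005, Prop. 5.2.2 and Prop. 5.8.5] ·
[cite: AtkinLi1978, §3 (Thm. 3.2, Cor. 3.1)] · [cite: MazurTateTeitelbaum1986Invent, §I.14 (case p ∣ N)].
-/

noncomputable section

open scoped MatrixGroups

open CongruenceSubgroup UpperHalfPlane Complex Function
open Literature.NumberTheory.EllipticCurves Literature.NumberTheory.EllipticCurves.ModularForms

-- single-conjunct summit: `Summit.BirchSwinnertonDyer.BirchSwinnertonDyer.…` repeats the name by design
set_option linter.dupNamespace false
set_option autoImplicit false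

namespace Summit.BirchSwinnertonDyer.BirchSwinnertonDyer.Theorems.PSStabilisedUntwist

/-! ### §1 From `q`-expansion coefficients to the functional identity `G(τ) − α G(pτ) = H(τ)` -/

section Analytic

variable {Γ Γ' : Subgroup (GL (Fin 2) ℝ)} {k k' : ℤ}

/-- The point `pτ ∈ ℍ` (`p ≥ 1`): `ofComplex (p·τ)` has underlying complex number `p·τ`. [folklore] -/
theorem coe_ofComplex_natCast_mul {p : ℕ} (hp : 0 < p) (τ : ℍ) :
    ((ofComplex ((p : ℂ) * (τ : ℂ)) : ℍ) : ℂ) = (p : ℂ) * (τ : ℂ) := by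
  have him : 0 < ((p : ℂ) * (τ : ℂ)).im := by simpa using mul_pos (Nat.cast_pos.mpr hp) τ.2
  rw [ofComplex_apply_of_im_pos him]

/-- `𝕢₁(pτ) = 𝕢₁(τ)^p`. [folklore] -/
theorem qParam_ofComplex_natCast_mul {p : ℕ} (hp : 0 < p) (τ : ℍ) :
    Periodic.qParam 1 (((ofComplex ((p : ℂ) * (τ : ℂ)) : ℍ) : ℂ)) = Periodic.qParam 1 (τ : ℂ) ^ p := by
  rw [coe_ofComplex_natCast_mul hp τ]
  simp only [Periodic.qParam, Complex.ofReal_one, div_one, ← Complex.exp_nat_mul]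
  congr 1
  ring

/-- **From coefficients to the functional identity.** Let `G`, `H` be cusp forms (any weights) for
levels `Γ`, `Γ'` with strict period `1`, `p ≥ 1` and `α ∈ ℂ`. If the `q`-expansion coefficients satisfy
`aₙ(G) − α·[p ∣ n]·a_{n/p}(G) = aₙ(H)` for every `n`, then `G(τ) − α·G(pτ) = H(τ)` for every `τ ∈ ℍ`:
`G(pτ) = ∑ aₙ(G) 𝕢(τ)^{pn}` is the series `∑_{p ∣ m} a_{m/p}(G) 𝕢(τ)^m` (re-indexing along the injection
`n ↦ pn`), and the three `q`-expansions converge (Diamond–Shurman Prop. 5.2.2).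
[cite: DiamondShurman2005, Prop. 5.2.2 p. 171] -/
theorem apply_sub_mul_apply_mul_eq_of_cuspCoeff (hΓ : (1 : ℝ) ∈ Γ.strictPeriods)
    (hΓ' : (1 : ℝ) ∈ Γ'.strictPeriods) (G : CuspForm Γ k) (H : CuspForm Γ' k') {p : ℕ} (hp : 0 < p)
    (α : ℂ) (hcoeff : ∀ n : ℕ,
      cuspCoeff G n - α * (if p ∣ n then cuspCoeff G (n / p) else 0) = cuspCoeff H n) (τ : ℍ) :
    G τ - α * G (ofComplex ((p : ℂ) * (τ : ℂ))) = H τ := by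
  haveI : Fact (IsCusp OnePoint.infty Γ) := ⟨Γ.isCusp_of_mem_strictPeriods one_pos hΓ⟩
  haveI : Fact (IsCusp OnePoint.infty Γ') := ⟨Γ'.isCusp_of_mem_strictPeriods one_pos hΓ'⟩
  -- the three convergent `q`-expansions (`cuspCoeff X n` is `(qExpansion 1 ⇑X).coeff n` by definition)
  have hG : HasSum (fun n : ℕ ↦ cuspCoeff G n • Periodic.qParam 1 (τ : ℂ) ^ n) (G τ) :=
    hasSum_qExpansion one_pos (SlashInvariantFormClass.periodic_comp_ofComplex G hΓ)
      (ModularFormClass.holo G) (ModularFormClass.bdd_at_infty G) τ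
  have hH : HasSum (fun n : ℕ ↦ cuspCoeff H n • Periodic.qParam 1 (τ : ℂ) ^ n) (H τ) :=
    hasSum_qExpansion one_pos (SlashInvariantFormClass.periodic_comp_ofComplex H hΓ')
      (ModularFormClass.holo H) (ModularFormClass.bdd_at_infty H) τ
  have hGp : HasSum (fun n : ℕ ↦ cuspCoeff G n • Periodic.qParam 1 (τ : ℂ) ^ (p * n))
      (G (ofComplex ((p : ℂ) * (τ : ℂ)))) := by
    have h : HasSum (fun n : ℕ ↦ cuspCoeff G n •
        Periodic.qParam 1 (((ofComplex ((p : ℂ) * (τ : ℂ)) : ℍ) : ℂ)) ^ n)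
        (G (ofComplex ((p : ℂ) * (τ : ℂ)))) :=
      hasSum_qExpansion one_pos (SlashInvariantFormClass.periodic_comp_ofComplex G hΓ)
        (ModularFormClass.holo G) (ModularFormClass.bdd_at_infty G) (ofComplex ((p : ℂ) * (τ : ℂ)))
    refine h.congr_fun fun n ↦ ?_
    rw [qParam_ofComplex_natCast_mul hp τ, ← pow_mul]
  -- re-index `G(pτ)` along the injection `n ↦ p n`
  have hinj : Function.Injective (fun n : ℕ ↦ p * n) := fun a b hab ↦
    Nat.eq_of_mul_eq_mul_left hp hab
  have hFp : HasSum (fun n : ℕ ↦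
      if p ∣ n then cuspCoeff G (n / p) • Periodic.qParam 1 (τ : ℂ) ^ n else 0)
      (G (ofComplex ((p : ℂ) * (τ : ℂ)))) := by
    refine (hinj.hasSum_iff ?_).mp ?_
    · intro n hn
      rw [if_neg]
      rintro ⟨n', rfl⟩
      exact hn ⟨n', rfl⟩
    · refine hGp.congr_fun fun n ↦ ?_
      simp only [Function.comp_apply, if_pos (dvd_mul_right p n), Nat.mul_div_cancel_left n hp]
  -- subtract and compare coefficients
  have hdiff := hG.sub (hFp.mul_left α)
  have heq : (fun n : ℕ ↦ cuspCoeff G n • Periodic.qParam 1 (τ : ℂ) ^ n -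
      α * (if p ∣ n then cuspCoeff G (n / p) • Periodic.qParam 1 (τ : ℂ) ^ n else 0)) =
      fun n ↦ cuspCoeff H n • Periodic.qParam 1 (τ : ℂ) ^ n := by
    funext n
    rw [← hcoeff n]
    split_ifs <;> simp only [smul_eq_mul] <;> ring
  rw [heq] at hdiff
  exact hdiff.unique hH

end Analytic

/-! ### §2 The eigenpacket of the untwist: `aₙ(g₀) = η⁻¹(n) aₙ(f)` off `p`, and `a_{pn}(g₀) = a_p(g₀) aₙ(g₀)` -/

section Packet

variable {N N₀ : ℕ} [NeZero N] [NeZero N₀] {k : ℤ} {m : ℕ} {p : ℕ}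
variable {f : CuspForm (Gamma0 N) k} {η : DirichletCharacter ℂ m} {g₀ : CuspForm (Gamma1 N₀) k}

/-- A Dirichlet character mod `m` vanishes on the multiples of a prime `p ∣ m`. [folklore] -/
theorem apply_natCast_eq_zero_of_dvd (χ : DirichletCharacter ℂ m) (hp : p.Prime) (hpm : p ∣ m) {n : ℕ}
    (hpn : p ∣ n) : χ (n : ZMod m) = 0 := by
  refine MulChar.map_nonunit χ fun hu ↦ ?_
  rw [ZMod.isUnit_iff_coprime] at hu
  exact (Nat.Prime.not_coprime_iff_dvd.mpr ⟨p, hp, hpn, hpm⟩) hu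
/-- The nebentypus of a `Γ₁(N₀)`-form vanishes at a prime dividing the level. [folklore] -/
theorem nebentypus_natCast_eq_zero_of_dvd (g : CuspForm (Gamma1 N₀) k) {ℓ : ℕ} (hℓ : ℓ.Prime)
    (hℓN₀ : ℓ ∣ N₀) : nebentypus g (ℓ : ZMod N₀) = 0 :=
  MulChar.map_nonunit _ (by rw [ZMod.isUnit_prime_iff_not_dvd hℓ]; exact fun h ↦ h hℓN₀)

/-- **`U_p` on a newform of level divisible by `p`**: `a_{pn}(g₀) = a_p(g₀)·aₙ(g₀)` for every `n`
(`T_p g₀ = a_p g₀` and the `q`-expansion of `T_p = U_p` when `p ∣ N₀`, Diamond–Shurman (5.3)).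
[cite: DiamondShurman2005, Prop. 5.2.2 and Prop. 5.8.5] -/
theorem cuspCoeff_prime_mul_of_dvd_level (hg₀ : IsNewform1 g₀) (hp : p.Prime) (hpN₀ : p ∣ N₀) (n : ℕ) :
    cuspCoeff g₀ (p * n) = cuspCoeff g₀ p * cuspCoeff g₀ n := by
  haveI : NeZero p := ⟨hp.ne_zero⟩
  have h := cuspCoeff_heckeT_gamma1 g₀ p hp n
  rw [hg₀.heckeT_apply_eq_cuspCoeff_smul p hp, cuspCoeff_smul_gamma1, if_pos hpN₀, add_zero] at h
  exact h.symm

/-- **Prime powers off `p`.** Under the packet hypotheses (`a_ℓ(g₀) = η⁻¹(ℓ)a_ℓ(f)` for primes `ℓ ≠ p`,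
`ε_{g₀}(ℓ) = η⁻¹(ℓ)²` for primes `ℓ ∤ N m`, `ℓ ∣ N₀` for primes `ℓ ∣ N m` other than `p`), for a prime `ℓ ≠ p`
and every `e`: `a_{ℓ^e}(g₀) = η⁻¹(ℓ)^e a_{ℓ^e}(f)` and the same at `e + 1` — two-step induction on the Hecke
recursions `a_{ℓ^{e+2}} = a_ℓ a_{ℓ^{e+1}} − ε(ℓ) ℓ^{k−1} a_{ℓ^e}` on `Γ₁(N₀)` (`ε = ε_{g₀}`) and on `Γ₀(N)`
(`ε = 𝟙_N`): for `ℓ ∤ N m` the corrections match (`ε_{g₀}(ℓ) = η⁻¹(ℓ)²`), for `ℓ ∣ N` both vanish (`ℓ ∣ N₀`),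
for `ℓ ∣ m`, `ℓ ∤ N` everything is killed by `η⁻¹(ℓ) = 0`. [cite: DiamondShurman2005, Prop. 5.8.5 (2)] -/
theorem cuspCoeff_prime_pow_eq_of_packet (hf : IsNewform0 f) (hg₀ : IsNewform1 g₀)
    (hcoef : ∀ ℓ : ℕ, ℓ.Prime → ℓ ≠ p → cuspCoeff g₀ ℓ = η⁻¹ (ℓ : ZMod m) * cuspCoeff f ℓ)
    (hchar : ∀ ℓ : ℕ, ℓ.Prime → ¬ ℓ ∣ N * m → nebentypus g₀ (ℓ : ZMod N₀) = η⁻¹ (ℓ : ZMod m) ^ 2)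
    (hlev : ∀ ℓ : ℕ, ℓ.Prime → ℓ ∣ N * m → ℓ ≠ p → ℓ ∣ N₀)
    {ℓ : ℕ} (hℓ : ℓ.Prime) (hℓp : ℓ ≠ p) (e : ℕ) :
    cuspCoeff g₀ (ℓ ^ e) = η⁻¹ (ℓ : ZMod m) ^ e * cuspCoeff f (ℓ ^ e) ∧
      cuspCoeff g₀ (ℓ ^ (e + 1)) = η⁻¹ (ℓ : ZMod m) ^ (e + 1) * cuspCoeff f (ℓ ^ (e + 1)) := by
  induction e with
  | zero =>
    refine ⟨?_, ?_⟩
    · rw [pow_zero, pow_zero, hg₀.cuspCoeff_one, show cuspCoeff f 1 = 1 from hf.2.2, mul_one]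
    · rw [zero_add, pow_one, pow_one, hcoef ℓ hℓ hℓp]
  | succ e ih =>
    refine ⟨ih.2, ?_⟩
    have hrg := IsNewform1.cuspCoeff_prime_pow_add_two_holds hg₀ hℓ e
    have hrf := hf.cuspCoeff_prime_pow_add_two_weight hℓ e
    rw [show e + 1 + 1 = e + 2 from rfl, hrg, ih.1, ih.2, hcoef ℓ hℓ hℓp, hrf]
    by_cases hℓNm : ℓ ∣ N * m
    · rw [nebentypus_natCast_eq_zero_of_dvd g₀ hℓ (hlev ℓ hℓ hℓNm hℓp)]
      by_cases hℓN : ℓ ∣ N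
      · rw [if_pos hℓN]
        ring
      · have hℓm : ℓ ∣ m := ((Nat.Prime.dvd_mul hℓ).mp hℓNm).resolve_left hℓN
        rw [apply_natCast_eq_zero_of_dvd η⁻¹ hℓ hℓm dvd_rfl, if_neg hℓN]
        simp
    · have hℓN : ¬ ℓ ∣ N := fun h ↦ hℓNm (h.mul_right m)
      rw [hchar ℓ hℓ hℓNm, if_neg hℓN]
      ring

/-- **The eigenpacket of the untwist off `p`: `aₙ(g₀) = η⁻¹(n)·aₙ(f)` for `p ∤ n`.** For a newform
`f ∈ S_k(Γ₀(N))`, a character `η` mod `m`, and a newform `g₀ ∈ S_k(Γ₁(N₀))` with `a_ℓ(g₀) = η⁻¹(ℓ)a_ℓ(f)`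
(primes `ℓ ≠ p`), `ε_{g₀}(ℓ) = η⁻¹(ℓ)²` (primes `ℓ ∤ N m`) and `ℓ ∣ N₀` for the primes `ℓ ∣ N m`, `ℓ ≠ p`.
Induction over the factorisation of `n` (`Nat.recOnPosPrimePosCoprime`): prime powers by
`cuspCoeff_prime_pow_eq_of_packet`, coprime products by multiplicativity on both levels
(Diamond–Shurman Prop. 5.8.5 (3)) and of `η⁻¹`. [cite: DiamondShurman2005, Prop. 5.8.5] [cite: AtkinLi1978, §3] -/
theorem cuspCoeff_eq_inv_mul_of_packet (hf : IsNewform0 f) (hg₀ : IsNewform1 g₀) (hp : p.Prime)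
    (hcoef : ∀ ℓ : ℕ, ℓ.Prime → ℓ ≠ p → cuspCoeff g₀ ℓ = η⁻¹ (ℓ : ZMod m) * cuspCoeff f ℓ)
    (hchar : ∀ ℓ : ℕ, ℓ.Prime → ¬ ℓ ∣ N * m → nebentypus g₀ (ℓ : ZMod N₀) = η⁻¹ (ℓ : ZMod m) ^ 2)
    (hlev : ∀ ℓ : ℕ, ℓ.Prime → ℓ ∣ N * m → ℓ ≠ p → ℓ ∣ N₀)
    {n : ℕ} (hpn : ¬ p ∣ n) : cuspCoeff g₀ n = η⁻¹ (n : ZMod m) * cuspCoeff f n := by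
  induction n using Nat.recOnPosPrimePosCoprime with
  | zero => exact absurd (dvd_zero p) hpn
  | one => rw [hg₀.cuspCoeff_one, show cuspCoeff f 1 = 1 from hf.2.2, Nat.cast_one, map_one, mul_one]
  | prime_pow ℓ e hℓ he =>
    have hℓp : ℓ ≠ p := by
      rintro rfl
      exact hpn (dvd_pow_self ℓ he.ne')
    rw [(cuspCoeff_prime_pow_eq_of_packet hf hg₀ hcoef hchar hlev hℓ hℓp e).1, Nat.cast_pow, map_pow]
  | coprime a b ha hb hab iha ihb =>
    have hpa : ¬ p ∣ a := fun h ↦ hpn (h.mul_right b)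
    have hpb : ¬ p ∣ b := fun h ↦ hpn (h.mul_left a)
    rw [IsNewform1.cuspCoeff_mul_of_coprime_holds hg₀ hab, iha hpa, ihb hpb,
      show cuspCoeff f (a * b) = cuspCoeff f a * cuspCoeff f b from
        IsNewform0.coeff_mul_of_coprime_holds hf hab, Nat.cast_mul, map_mul]
    ring

end Packet

/-! ### §3 The `α`-stabilised untwist `G = τ(η)•g₀`: its coefficients and the functional identity (★) -/

section Untwist

variable {N N₀ : ℕ} [NeZero N] [NeZero N₀] {k : ℤ} {m : ℕ} [NeZero m] {p : ℕ}
variable {f : CuspForm (Gamma0 N) k} {η : DirichletCharacter ℂ m} {g₀ : CuspForm (Gamma1 N₀) k}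
variable (L : ℕ) [NeZero L]

/-- **Coefficients of the `α`-stabilised untwist.** With `α := a_p(g₀)`, `G := τ(η)•g₀` (`τ(η)` the Gauss
sum of `η` for `e^{2πi·/m}`) and `H := ∑_u η(u) f(· + u/m)` (the tree's `twistRaw L _ _ f η⁻¹`, a cusp form
on `Γ₁(L)`, `N ∣ L`, `m² ∣ L`): `aₙ(G) − α·[p ∣ n]·a_{n/p}(G) = aₙ(H)` for every `n` — for `p ∣ n` both
sides vanish (`U_p`; `η⁻¹(n) = 0`), for `p ∤ n` it is `cuspCoeff_eq_inv_mul_of_packet` and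
`aₙ(H) = η⁻¹(n) τ(η) aₙ(f)` (`cuspCoeff_twistRaw`, Shimura 3.64). [cite: Shimura1971, Prop. 3.64]
[cite: DiamondShurman2005, Prop. 5.8.5] -/
theorem cuspCoeff_stabilisedUntwist (hNL : N ∣ L) (hmL : m ^ 2 ∣ L) (hf : IsNewform0 f)
    (hη : η.IsPrimitive) (hg₀ : IsNewform1 g₀) (hp : p.Prime) (hpm : p ∣ m) (hpN₀ : p ∣ N₀)
    (hcoef : ∀ ℓ : ℕ, ℓ.Prime → ℓ ≠ p → cuspCoeff g₀ ℓ = η⁻¹ (ℓ : ZMod m) * cuspCoeff f ℓ)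
    (hchar : ∀ ℓ : ℕ, ℓ.Prime → ¬ ℓ ∣ N * m → nebentypus g₀ (ℓ : ZMod N₀) = η⁻¹ (ℓ : ZMod m) ^ 2)
    (hlev : ∀ ℓ : ℕ, ℓ.Prime → ℓ ∣ N * m → ℓ ≠ p → ℓ ∣ N₀) (n : ℕ) :
    cuspCoeff (gaussSum η (ZMod.stdAddChar (N := m)) • g₀) n -
        cuspCoeff g₀ p * (if p ∣ n then cuspCoeff (gaussSum η (ZMod.stdAddChar (N := m)) • g₀) (n / p)
          else 0) =
      cuspCoeff (twistRaw L hNL hmL f η⁻¹) n := by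
  rw [cuspCoeff_twistRaw L hNL hmL f (isPrimitive_inv hη) n, inv_inv, cuspCoeff_smul_gamma1]
  by_cases hpn : p ∣ n
  · obtain ⟨n', rfl⟩ := hpn
    rw [if_pos (dvd_mul_right p n'), Nat.mul_div_cancel_left n' hp.pos, cuspCoeff_smul_gamma1,
      cuspCoeff_prime_mul_of_dvd_level hg₀ hp hpN₀ n',
      apply_natCast_eq_zero_of_dvd η⁻¹ hp hpm (dvd_mul_right p n')]
    ring
  · rw [if_neg hpn, cuspCoeff_eq_inv_mul_of_packet hf hg₀ hp hcoef hchar hlev hpn]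
    ring

/-- **The functional identity (★) of the `α`-stabilised untwist, `twistRaw` form.** Let `f ∈ S_k(Γ₀(N))` be
a newform, `η` a PRIMITIVE Dirichlet character mod `m`, `p` a prime with `p ∣ m`, and `g₀ ∈ S_k(Γ₁(N₀))` a
newform with `p ∣ N₀` carrying the eigenpacket of `f ⊗ η⁻¹` off `p`: `a_ℓ(g₀) = η⁻¹(ℓ)a_ℓ(f)` for primes
`ℓ ≠ p`, `ε_{g₀}(ℓ) = η⁻¹(ℓ)²` for primes `ℓ ∤ N m`, and `ℓ ∣ N₀` for primes `ℓ ∣ N m`, `ℓ ≠ p`. Then with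
`α := a_p(g₀)` and `G := τ(η)•g₀ ∈ S_k(Γ₁(N₀))`, for every `τ ∈ ℍ`:
`G(τ) − α·G(pτ) = (twistRaw L _ _ f η⁻¹)(τ)` (any `L` with `N ∣ L`, `m² ∣ L`). [cite: Shimura1971, Prop. 3.64]
[cite: AtkinLi1978, §3] [cite: MazurTateTeitelbaum1986Invent, §I.14 (case p ∣ N)] -/
theorem stabilisedUntwist_sub_mul_apply_mul_eq_twistRaw (hNL : N ∣ L) (hmL : m ^ 2 ∣ L)
    (hf : IsNewform0 f) (hη : η.IsPrimitive) (hg₀ : IsNewform1 g₀) (hp : p.Prime) (hpm : p ∣ m)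
    (hpN₀ : p ∣ N₀)
    (hcoef : ∀ ℓ : ℕ, ℓ.Prime → ℓ ≠ p → cuspCoeff g₀ ℓ = η⁻¹ (ℓ : ZMod m) * cuspCoeff f ℓ)
    (hchar : ∀ ℓ : ℕ, ℓ.Prime → ¬ ℓ ∣ N * m → nebentypus g₀ (ℓ : ZMod N₀) = η⁻¹ (ℓ : ZMod m) ^ 2)
    (hlev : ∀ ℓ : ℕ, ℓ.Prime → ℓ ∣ N * m → ℓ ≠ p → ℓ ∣ N₀) (τ : ℍ) :
    (gaussSum η (ZMod.stdAddChar (N := m)) • g₀) τ -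
        cuspCoeff g₀ p * (gaussSum η (ZMod.stdAddChar (N := m)) • g₀) (ofComplex ((p : ℂ) * (τ : ℂ))) =
      twistRaw L hNL hmL f η⁻¹ τ :=
  apply_sub_mul_apply_mul_eq_of_cuspCoeff (HeckeTGamma1.one_mem_strictPeriods_Gamma1 N₀)
    (HeckeTGamma1.one_mem_strictPeriods_Gamma1 L) _ _ hp.pos _
    (cuspCoeff_stabilisedUntwist L hNL hmL hf hη hg₀ hp hpm hpN₀ hcoef hchar hlev) τ

/-- The raw twist pointwise: `(twistRaw L _ _ f χ)(τ) = ∑_{u mod m} χ⁻¹(u) f(u/m +ᵥ τ)`. [cite: Shimura1971, Prop. 3.64] -/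
theorem twistRaw_apply (hNL : N ∣ L) (hmL : m ^ 2 ∣ L) (f : CuspForm (Gamma0 N) k)
    (χ : DirichletCharacter ℂ m) (τ : ℍ) :
    twistRaw L hNL hmL f χ τ = ∑ u : ZMod m, χ⁻¹ u * f ((((twistShift u : ℚ) : ℝ)) +ᵥ τ) := by
  rw [show twistRaw L hNL hmL f χ τ = (⇑(twistRaw L hNL hmL f χ) : ℍ → ℂ) τ from rfl, coe_twistRaw,
    Finset.sum_apply]
  refine Finset.sum_congr rfl fun u _ ↦ ?_
  rw [Pi.smul_apply, slash_twistT_apply, smul_eq_mul]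

/-- **(★) unfolded**: under the hypotheses of `stabilisedUntwist_sub_mul_apply_mul_eq_twistRaw`,
`G(τ) − α·G(pτ) = ∑_{u mod m} η(u) · f(u/m +ᵥ τ)` for every `τ ∈ ℍ` (`G = τ(η)•g₀`, `α = a_p(g₀)`,
`u/m = twistShift u`). [cite: Shimura1971, Prop. 3.64] [cite: AtkinLi1978, §3] -/
theorem stabilisedUntwist_sub_mul_apply_mul_eq_sum (hf : IsNewform0 f) (hη : η.IsPrimitive)
    (hg₀ : IsNewform1 g₀) (hp : p.Prime) (hpm : p ∣ m) (hpN₀ : p ∣ N₀)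
    (hcoef : ∀ ℓ : ℕ, ℓ.Prime → ℓ ≠ p → cuspCoeff g₀ ℓ = η⁻¹ (ℓ : ZMod m) * cuspCoeff f ℓ)
    (hchar : ∀ ℓ : ℕ, ℓ.Prime → ¬ ℓ ∣ N * m → nebentypus g₀ (ℓ : ZMod N₀) = η⁻¹ (ℓ : ZMod m) ^ 2)
    (hlev : ∀ ℓ : ℕ, ℓ.Prime → ℓ ∣ N * m → ℓ ≠ p → ℓ ∣ N₀) (τ : ℍ) :
    (gaussSum η (ZMod.stdAddChar (N := m)) • g₀) τ -
        cuspCoeff g₀ p * (gaussSum η (ZMod.stdAddChar (N := m)) • g₀) (ofComplex ((p : ℂ) * (τ : ℂ))) =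
      ∑ u : ZMod m, η u * f ((((twistShift u : ℚ) : ℝ)) +ᵥ τ) := by
  haveI : NeZero (N * m ^ 2) := ⟨mul_ne_zero (NeZero.ne N) (pow_ne_zero 2 (NeZero.ne m))⟩
  rw [stabilisedUntwist_sub_mul_apply_mul_eq_twistRaw (N * m ^ 2) (dvd_mul_right N _) (dvd_mul_left _ N)
    hf hη hg₀ hp hpm hpN₀ hcoef hchar hlev τ, twistRaw_apply]
  simp only [inv_inv]

/-- **(★) in the shape of `PSStabilisedTwist`** (prime-power conductor `m = p^c`, `c ≥ 1`): under the same
hypotheses, `G(τ) − α·G(pτ) = 1 · ∑_{u mod p^c} η(u) f(u.val/p^c +ᵥ τ)` — literally the hypothesis `hG` of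
`PSStabilisedTwist.psi_sub_eq_sum_ratPlusSymbol` with `G := τ(η)•g₀`, `α := a_p(g₀)`, `κ := 1`.
[cite: Shimura1971, Prop. 3.64] [cite: AtkinLi1978, §3] -/
theorem stabilisedUntwist_hG {c : ℕ} [NeZero (p ^ c)] {η : DirichletCharacter ℂ (p ^ c)}
    (hf : IsNewform0 f) (hη : η.IsPrimitive) (hg₀ : IsNewform1 g₀) (hp : p.Prime) (hc : c ≠ 0)
    (hpN₀ : p ∣ N₀)
    (hcoef : ∀ ℓ : ℕ, ℓ.Prime → ℓ ≠ p → cuspCoeff g₀ ℓ = η⁻¹ (ℓ : ZMod (p ^ c)) * cuspCoeff f ℓ)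
    (hchar : ∀ ℓ : ℕ, ℓ.Prime → ¬ ℓ ∣ N * p ^ c →
      nebentypus g₀ (ℓ : ZMod N₀) = η⁻¹ (ℓ : ZMod (p ^ c)) ^ 2)
    (hlev : ∀ ℓ : ℕ, ℓ.Prime → ℓ ∣ N * p ^ c → ℓ ≠ p → ℓ ∣ N₀) (τ : ℍ) :
    (gaussSum η (ZMod.stdAddChar (N := p ^ c)) • g₀) τ -
        cuspCoeff g₀ p * (gaussSum η (ZMod.stdAddChar (N := p ^ c)) • g₀) (ofComplex ((p : ℂ) * (τ : ℂ))) =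
      1 * ∑ u : ZMod (p ^ c), η u * f ((((u.val : ℚ) / (p : ℚ) ^ c : ℚ) : ℝ) +ᵥ τ) := by
  rw [stabilisedUntwist_sub_mul_apply_mul_eq_sum hf hη hg₀ hp (dvd_pow_self p hc) hpN₀ hcoef hchar hlev τ,
    one_mul]
  refine Finset.sum_congr rfl fun u _ ↦ ?_
  rw [twistShift, Nat.cast_pow]

end Untwist

/-! ### §4 Plugging in the newform of the twist: (★) from the RESIDUAL PACKET hypothesis -/

section Residual

variable {N : ℕ} [NeZero N] {k : ℤ} {p c : ℕ} [NeZero (p ^ c)]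
variable {f : CuspForm (Gamma0 N) k} {η : DirichletCharacter ℂ (p ^ c)}

/-- The lift `S_k(Γ₀(N)) → S_k(Γ₁(N))` does not change the Fourier coefficients. [folklore] -/
theorem cuspCoeff_liftToGamma1 (f : CuspForm (Gamma0 N) k) (n : ℕ) :
    cuspCoeff (liftToGamma1 N k f) n = cuspCoeff f n := by
  unfold cuspCoeff
  rw [coe_liftToGamma1_holds N k f]

/-- **(★) FROM THE RESIDUAL PACKET.** Let `f ∈ S_k(Γ₀(N))` be a newform, `p` a prime, `η` a primitive
Dirichlet character mod `p^c` (`c ≥ 1`). The tree's `exists_isNewform1_twist` gives a newform `g₀` of some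
level `N₀ ∣ N p^{2c}` with `a_ℓ(g₀) = η⁻¹(ℓ)a_ℓ(f)` and `ε_{g₀}(ℓ) = η⁻¹(ℓ)²` for every prime `ℓ ∤ N p^c`.
GRANTED the residual packet statement `hres` — every such `g₀` also satisfies `a_ℓ(g₀) = η⁻¹(ℓ)a_ℓ(f)` at the
primes `ℓ ∣ N p^c`, `ℓ ≠ p`, and `p ∣ N₀`, `ℓ ∣ N₀` for those `ℓ` (Atkin–Li 1978, Thm. 3.2 / Cor. 3.1 for the
newform of a twist; a HYPOTHESIS here) — the `α`-stabilised untwist EXISTS: a newform `g₀` with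
`(τ(η)•g₀)(τ) − a_p(g₀)·(τ(η)•g₀)(pτ) = 1·∑_{u mod p^c} η(u) f(u.val/p^c +ᵥ τ)` on `ℍ`, i.e. the hypothesis `hG`
of `PSStabilisedTwist` with `G = τ(η)•g₀`, `α = a_p(g₀)`, `κ = 1`. [cite: AtkinLi1978, §3 (Thm. 3.2, Cor. 3.1)]
[cite: Shimura1971, Prop. 3.64] [cite: DiamondShurman2005, Thm. 5.8.2] -/
theorem exists_stabilisedUntwist_of_residualPacket (hf : IsNewform0 f) (hη : η.IsPrimitive) (hp : p.Prime)
    (hc : c ≠ 0)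
    (hres : ∀ {N₀ : ℕ} [NeZero N₀] (g₀ : CuspForm (Gamma1 N₀) k), IsNewform1 g₀ → N₀ ∣ N * (p ^ c) ^ 2 →
      (∀ ℓ : ℕ, ℓ.Prime → ¬ ℓ ∣ N * p ^ c →
        cuspCoeff g₀ ℓ = η⁻¹ (ℓ : ZMod (p ^ c)) * cuspCoeff f ℓ ∧
          nebentypus g₀ (ℓ : ZMod N₀) = η⁻¹ (ℓ : ZMod (p ^ c)) ^ 2) →
      p ∣ N₀ ∧ (∀ ℓ : ℕ, ℓ.Prime → ℓ ∣ N * p ^ c → ℓ ≠ p →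
          cuspCoeff g₀ ℓ = η⁻¹ (ℓ : ZMod (p ^ c)) * cuspCoeff f ℓ) ∧
        (∀ ℓ : ℕ, ℓ.Prime → ℓ ∣ N * p ^ c → ℓ ≠ p → ℓ ∣ N₀)) :
    ∃ (N₀ : ℕ) (_ : NeZero N₀) (g₀ : CuspForm (Gamma1 N₀) k), IsNewform1 g₀ ∧ N₀ ∣ N * (p ^ c) ^ 2 ∧
      p ∣ N₀ ∧ (∀ n : ℕ, ¬ p ∣ n → cuspCoeff g₀ n = η⁻¹ (n : ZMod (p ^ c)) * cuspCoeff f n) ∧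
      ∀ τ : ℍ, (gaussSum η (ZMod.stdAddChar (N := p ^ c)) • g₀) τ -
          cuspCoeff g₀ p * (gaussSum η (ZMod.stdAddChar (N := p ^ c)) • g₀) (ofComplex ((p : ℂ) * (τ : ℂ))) =
        1 * ∑ u : ZMod (p ^ c), η u * f ((((u.val : ℚ) / (p : ℚ) ^ c : ℚ) : ℝ) +ᵥ τ) := by
  have hf₁ : IsNewform1 (liftToGamma1 N k f) := (isNewform1_liftToGamma1_iff_holds (N := N) (k := k) f).mpr hf
  have hf0 : f ≠ 0 := by
    intro h
    have h1 : cuspCoeff f 1 = 1 := hf.2.2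
    rw [h, cuspCoeff_zero_form (one_mem_strictPeriods_gamma0 N)] at h1
    exact zero_ne_one h1
  have hε : nebentypus (liftToGamma1 N k f) = 1 := nebentypus_liftToGamma1_holds (N := N) (k := k) hf0
  obtain ⟨N₀, _, hN₀, g₀, hg₀, hpack⟩ := exists_isNewform1_twist hf₁ (isPrimitive_inv hη)
  -- the packet off `N p^c`, rewritten from the lift to `f`
  have hpack' : ∀ ℓ : ℕ, ℓ.Prime → ¬ ℓ ∣ N * p ^ c →
      cuspCoeff g₀ ℓ = η⁻¹ (ℓ : ZMod (p ^ c)) * cuspCoeff f ℓ ∧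
        nebentypus g₀ (ℓ : ZMod N₀) = η⁻¹ (ℓ : ZMod (p ^ c)) ^ 2 := by
    intro ℓ hℓ hℓNm
    obtain ⟨h1, h2⟩ := hpack ℓ hℓ hℓNm
    have hℓN : ¬ ℓ ∣ N := fun h ↦ hℓNm (h.mul_right _)
    refine ⟨by rw [h1, cuspCoeff_liftToGamma1], ?_⟩
    rw [h2, hε, MulChar.one_apply ((ZMod.isUnit_prime_iff_not_dvd hℓ).mpr hℓN), one_mul]
  obtain ⟨hpN₀, hcoef', hlev⟩ := hres g₀ hg₀ hN₀ hpack'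
  have hcoef : ∀ ℓ : ℕ, ℓ.Prime → ℓ ≠ p → cuspCoeff g₀ ℓ = η⁻¹ (ℓ : ZMod (p ^ c)) * cuspCoeff f ℓ := by
    intro ℓ hℓ hℓp
    by_cases hℓNm : ℓ ∣ N * p ^ c
    · exact hcoef' ℓ hℓ hℓNm hℓp
    · exact (hpack' ℓ hℓ hℓNm).1
  have hchar : ∀ ℓ : ℕ, ℓ.Prime → ¬ ℓ ∣ N * p ^ c →
      nebentypus g₀ (ℓ : ZMod N₀) = η⁻¹ (ℓ : ZMod (p ^ c)) ^ 2 := fun ℓ hℓ hℓNm ↦ (hpack' ℓ hℓ hℓNm).2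
  exact ⟨N₀, inferInstance, g₀, hg₀, hN₀, hpN₀,
    fun n hpn ↦ cuspCoeff_eq_inv_mul_of_packet hf hg₀ hp hcoef hchar hlev hpn,
    fun τ ↦ stabilisedUntwist_hG hf hη hg₀ hp hc hpN₀ hcoef hchar hlev τ⟩

end Residual

end Summit.BirchSwinnertonDyer.BirchSwinnertonDyer.Theorems.PSStabilisedUntwist

end
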